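import Mathlib

/-!
# Chebyshev coefficients of differentiable functions (Trefethen 2008, Thm. 4.2)

For `f : [-1, 1] → ℂ` the Chebyshev coefficients are
`a_j(f) = (2/π) ∫_0^π f(cos θ) cos(jθ) dθ = (2/π) ∫_{-1}^{1} f(x) T_j(x) (1 - x²)^{-1/2} dx`
([cite: Trefethen2008, Thm. 4.2], eq. (4.4); `f = Σ' a_j T_j`, the prime halving `a_0`).

**Theorem 4.2 (4.6)** (loc. cit., p. 74): *if `f, f', …, f^{(k-1)}` are absolutely continuous on
`[-1, 1]` and `‖f^{(k)}‖_T = V < ∞` for some `k ≥ 0`, where `‖u‖_T = ‖u'(x) / √(1 - x²)‖_1`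
((4.5), a Stieltjes integral when `u` is merely of bounded variation), then for each
`n ≥ k + 1`, `|a_n| ≤ 2V / (π n (n-1) ⋯ (n-k))`.*

## What is formalised

`norm_chebCoeff_le_of_hasDerivAt`: for a chain `F 0 = f, F 1, …, F m` with `F i` continuous on
`[-1, 1]` and `F (i+1)` the derivative of `F i` at every point of `(-1, 1)` off a fixed countable
set `s` (`i < m`), and `θ ↦ F i (cos θ)` integrable on `[0, π]` (`i ≤ m`):
`|a_j(f)| ≤ (2/π) (∫_0^π |F m (cos θ)| dθ) / (j (j-1) ⋯ (j-m+1))` for `j ≥ m`.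
With `m = k + 1` and `V = ∫_0^π |f^{(k+1)}(cos θ)| dθ = ∫_{-1}^{1} |f^{(k+1)}(x)| (1-x²)^{-1/2} dx =
‖f^{(k)}‖_T` this is (4.6) for `f^{(k)}` continuous and piecewise `C¹` with integrable
`f^{(k+1)}(x) (1-x²)^{-1/2}` (in particular `f ∈ C^{k+1}[-1, 1]`).  The Stieltjes generality of
(4.5) (`f^{(k)}` merely of bounded variation, jumps allowed, e.g. `f = |x|`, `k = 1`) is NOT
formalised.  The proof is the one loc. cit.: `m` integrations by parts in the `θ` variable, each
an instance of `a_m(u) = (a_{m-1}(u') - a_{m+1}(u')) / (2m)` (`chebCoeff_eq_of_hasDerivAt`),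
then weakening the denominators.

Also here, for Theorems 4.3 and 4.5 loc. cit. (files `GaussLegendreAliasing`,
`GaussLegendreBoundedVariation`): the telescoped tail
`Σ_{j ≥ M} 1 / (j (j-1) ⋯ (j-k)) ≤ 1 / (k (M-1) (M-2) ⋯ (M-k))` (`tsum_one_div_descFactorial_le`;
(4.10) loc. cit. bounds the same tail by an integral) and `|∫_{-1}^{1} T_j(x) dx| ≤ 2 / (j² - 1)`
for `j ≥ 2` (`abs_integral_T_le`; (5.2)–(5.3) loc. cit.).

## References

* L. N. Trefethen, *Is Gauss quadrature better than Clenshaw–Curtis?*, SIAM Review **50** (2008)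
  67–87, Thm. 4.2, eqs. (4.4)–(4.6), (4.10), (5.2)–(5.3). [cite: Trefethen2008, Thm. 4.2 (4.6)]

AI-produced formalisation (H21 engines group, seat eng-quad-3, 2026-08-20); no facts, no axioms
beyond Mathlib's, no `sorry`.
-/

open Set MeasureTheory Filter

open scoped Real Interval

namespace Literature.Analysis.Quadrature

open Polynomial.Chebyshev

/-! ### Chebyshev coefficients and one integration by parts -/

/-- The `j`-th **Chebyshev coefficient** of `f : [-1, 1] → ℂ` in the transplanted variable
`x = cos θ`: `a_j = (2/π) ∫_0^π f(cos θ) cos(jθ) dθ` (`= (2/π) ∫_{-1}^{1} f(x) T_j(x) (1-x²)^{-1/2} dx`,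
Trefethen 2008 (4.4)). [cite: Trefethen2008, Thm. 4.2] -/
noncomputable def chebCoeff (f : ℝ → ℂ) (j : ℕ) : ℂ :=
  (2 / π : ℂ) * ∫ θ in (0 : ℝ)..π, f (Real.cos θ) * (Real.cos (j * θ) : ℂ)

/-- `θ ∈ (0, π) → cos θ ∈ (-1, 1)`. [folklore] -/
private theorem cos_mem_Ioo_of_mem_Ioo {θ : ℝ} (hθ : θ ∈ Ioo 0 π) : Real.cos θ ∈ Ioo (-1 : ℝ) 1 := by
  constructor
  · have h := Real.cos_lt_cos_of_nonneg_of_le_pi hθ.1.le le_rfl hθ.2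
    rwa [Real.cos_pi] at h
  · have h := Real.cos_lt_cos_of_nonneg_of_le_pi le_rfl hθ.2.le hθ.1
    rwa [Real.cos_zero] at h

/-- **One integration by parts in the `θ` variable** (Trefethen 2008, proof of Thm. 4.2): if `u` is
continuous on `[-1, 1]` with derivative `u'` on `(-1, 1)` off a countable set `s`, and
`θ ↦ u'(cos θ)` is integrable on `[0, π]`, then for `m ≥ 1`
`a_m(u) = (a_{m-1}(u') - a_{m+1}(u')) / (2m)`
(from `∫ u(cos θ) cos(mθ) dθ = (1/m) ∫ u'(cos θ) sin θ sin(mθ) dθ` and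
`2 sin θ sin(mθ) = cos((m-1)θ) - cos((m+1)θ)`; the boundary terms vanish because of the sine).
[cite: Trefethen2008, Thm. 4.2 (4.6)] -/
theorem chebCoeff_eq_of_hasDerivAt {u u' : ℝ → ℂ} {s : Set ℝ} (hs : s.Countable)
    (hu : ContinuousOn u (Icc (-1 : ℝ) 1)) (hd : ∀ x ∈ Ioo (-1 : ℝ) 1 \ s, HasDerivAt u (u' x) x)
    (hi : IntervalIntegrable (fun θ : ℝ => u' (Real.cos θ)) volume 0 π) {m : ℕ} (hm : 1 ≤ m) :
    chebCoeff u m = (chebCoeff u' (m - 1) - chebCoeff u' (m + 1)) / (2 * m) := by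
  have hm0 : (m : ℂ) ≠ 0 := by exact_mod_cast (show m ≠ 0 by omega)
  have hπ : (0 : ℝ) ≤ π := Real.pi_pos.le
  -- the two factors and their derivatives
  set U : ℝ → ℂ := fun θ => u (Real.cos θ) with hU
  set U' : ℝ → ℂ := fun θ => ((-Real.sin θ : ℝ) : ℂ) * u' (Real.cos θ) with hU'
  set V : ℝ → ℂ := fun θ => (Real.sin (m * θ) : ℂ) / m with hV
  set V' : ℝ → ℂ := fun θ => (Real.cos (m * θ) : ℂ) with hV'
  have hUc : ContinuousOn U (Icc 0 π) :=
    (hu.comp_continuous Real.continuous_cos Real.cos_mem_Icc).continuousOn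
  have hVc : Continuous V := by
    simp only [hV]
    fun_prop
  have hV'c : Continuous V' := by
    simp only [hV']
    fun_prop
  -- `U` is differentiable at every `θ ∈ (0, π)` off the countable set `arccos '' s`
  have hS : (Real.arccos '' s).Countable := hs.image _
  have hUd : ∀ θ ∈ Ioo 0 π \ Real.arccos '' s, HasDerivAt U (U' θ) θ := by
    rintro θ ⟨hθ, hθs⟩
    have hcs : Real.cos θ ∈ Ioo (-1 : ℝ) 1 \ s :=
      ⟨cos_mem_Ioo_of_mem_Ioo hθ, fun h =>
        hθs ⟨Real.cos θ, h, Real.arccos_cos hθ.1.le hθ.2.le⟩⟩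
    have h := (hd _ hcs).scomp θ (Real.hasDerivAt_cos θ)
    refine h.congr_deriv ?_
    simp only [hU', Complex.real_smul]
  have hVd : ∀ θ : ℝ, HasDerivAt V (V' θ) θ := by
    intro θ
    have h1 : HasDerivAt (fun θ : ℝ => Real.sin (m * θ)) (Real.cos (m * θ) * (m * 1)) θ :=
      ((hasDerivAt_id' θ).const_mul (m : ℝ)).sin
    have h2 := (h1.ofReal_comp).div_const (m : ℂ)
    refine h2.congr_deriv ?_
    simp only [hV']
    push_cast
    field_simp
  have hU'i : IntervalIntegrable U' volume 0 π :=
    hi.continuousOn_mul (by fun_prop)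
  have hi1 : IntervalIntegrable (fun θ => U' θ * V θ) volume 0 π :=
    hU'i.mul_continuousOn hVc.continuousOn
  have hi2 : IntervalIntegrable (fun θ => U θ * V' θ) volume 0 π :=
    (hUc.mul hV'c.continuousOn).intervalIntegrable_of_Icc hπ
  -- integrate `(U V)' = U' V + U V'` over `[0, π]` (FTC off a countable set); `V 0 = V π = 0`
  have hftc := MeasureTheory.integral_eq_of_hasDerivAt_off_countable_of_le (fun θ => U θ * V θ)
    (fun θ => U' θ * V θ + U θ * V' θ) hπ hS (hUc.mul hVc.continuousOn)
    (fun θ hθ => (hUd θ hθ).mul (hVd θ)) (hi1.add hi2)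
  have hV0 : V 0 = 0 := by simp [hV]
  have hVπ : V π = 0 := by
    simp only [hV]
    rw [Real.sin_nat_mul_pi]
    simp
  rw [hV0, hVπ, mul_zero, mul_zero, sub_zero, intervalIntegral.integral_add hi1 hi2] at hftc
  have hparts : (∫ θ in (0 : ℝ)..π, U θ * V' θ) = -∫ θ in (0 : ℝ)..π, U' θ * V θ := by
    linear_combination hftc
  -- the trigonometric identity
  have htrig : ∀ θ : ℝ, U' θ * V θ =
      -((1 / (2 * m) : ℂ) * (u' (Real.cos θ) *
        ((Real.cos ((m - 1 : ℕ) * θ) : ℂ) - (Real.cos ((m + 1 : ℕ) * θ) : ℂ)))) := by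
    intro θ
    have hc : ((m - 1 : ℕ) : ℝ) = (m : ℝ) - 1 := by
      rw [Nat.cast_sub hm, Nat.cast_one]
    have e : Real.cos ((m - 1 : ℕ) * θ) - Real.cos ((m + 1 : ℕ) * θ) =
        2 * Real.sin θ * Real.sin (m * θ) := by
      rw [hc]
      push_cast
      rw [show ((m : ℝ) - 1) * θ = m * θ - θ by ring, show ((m : ℝ) + 1) * θ = m * θ + θ by ring,
        Real.cos_sub, Real.cos_add]
      ring
    have e' : ((Real.cos ((m - 1 : ℕ) * θ) : ℂ) - (Real.cos ((m + 1 : ℕ) * θ) : ℂ)) =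
        2 * (Real.sin θ : ℂ) * (Real.sin (m * θ) : ℂ) := by
      exact_mod_cast e
    rw [e']
    simp only [hU', hV]
    push_cast
    field_simp
  have hint2 : (∫ θ in (0 : ℝ)..π, U' θ * V θ) =
      -((1 / (2 * m) : ℂ) * ∫ θ in (0 : ℝ)..π, u' (Real.cos θ) *
        ((Real.cos ((m - 1 : ℕ) * θ) : ℂ) - (Real.cos ((m + 1 : ℕ) * θ) : ℂ))) := by
    simp_rw [htrig]
    rw [intervalIntegral.integral_neg, intervalIntegral.integral_const_mul]
  have hsplit : (∫ θ in (0 : ℝ)..π, u' (Real.cos θ) *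
      ((Real.cos ((m - 1 : ℕ) * θ) : ℂ) - (Real.cos ((m + 1 : ℕ) * θ) : ℂ))) =
      (∫ θ in (0 : ℝ)..π, u' (Real.cos θ) * (Real.cos ((m - 1 : ℕ) * θ) : ℂ)) -
        ∫ θ in (0 : ℝ)..π, u' (Real.cos θ) * (Real.cos ((m + 1 : ℕ) * θ) : ℂ) := by
    simp_rw [mul_sub]
    exact intervalIntegral.integral_sub (hi.mul_continuousOn (by fun_prop))
      (hi.mul_continuousOn (by fun_prop))
  simp only [chebCoeff]
  rw [show (∫ θ in (0 : ℝ)..π, u (Real.cos θ) * (Real.cos (m * θ) : ℂ)) =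
      ∫ θ in (0 : ℝ)..π, U θ * V' θ from rfl, hparts, hint2, hsplit]
  field_simp

/-- `|a_j(u)| ≤ (2/π) ∫_0^π |u(cos θ)| dθ`. [folklore] -/
private theorem norm_chebCoeff_le {u : ℝ → ℂ}
    (hi : IntervalIntegrable (fun θ : ℝ => u (Real.cos θ)) volume 0 π) (j : ℕ) :
    ‖chebCoeff u j‖ ≤ 2 / π * ∫ θ in (0 : ℝ)..π, ‖u (Real.cos θ)‖ := by
  have hπ : (0 : ℝ) ≤ π := Real.pi_pos.le
  have hn : ‖(2 / π : ℂ)‖ = 2 / π := by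
    rw [show (2 / π : ℂ) = ((2 / π : ℝ) : ℂ) by push_cast; rfl, Complex.norm_real,
      Real.norm_of_nonneg (by positivity)]
  rw [chebCoeff, norm_mul, hn]
  refine mul_le_mul_of_nonneg_left ?_ (by positivity)
  refine (intervalIntegral.norm_integral_le_integral_norm hπ).trans ?_
  refine intervalIntegral.integral_mono_on hπ ((hi.mul_continuousOn (by fun_prop)).norm) hi.norm
    fun θ _ => ?_
  rw [norm_mul, Complex.norm_real, Real.norm_eq_abs]
  exact mul_le_of_le_one_right (norm_nonneg _) (Real.abs_cos_le_one _)

/-! ### Theorem 4.2 (4.6) -/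

/-- **Chebyshev coefficients of a `k + 1` times differentiable function** (Trefethen 2008, Thm. 4.2,
eq. (4.6), in the generality: `F 0 = f, F 1 = f', …` with `F i` continuous on `[-1, 1]` and
`F (i+1)` the derivative of `F i` on `(-1, 1)` off a countable set `s` for `i < m`, and
`θ ↦ F i (cos θ)` integrable on `[0, π]` for `i ≤ m`): for `j ≥ m`,
`|a_j(f)| ≤ (2/π) (∫_0^π |F m (cos θ)| dθ) / (j (j-1) ⋯ (j-m+1))`.
With `m = k + 1` and `V = ∫_0^π |f^{(k+1)}(cos θ)| dθ = ‖f^{(k)}‖_T` this is (4.6):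
`|a_j| ≤ 2V / (π j (j-1) ⋯ (j-k))` for `j ≥ k + 1`.  Proof by `m` integrations by parts
(`chebCoeff_eq_of_hasDerivAt`), weakening the denominators as loc. cit.
[cite: Trefethen2008, Thm. 4.2 (4.6)] -/
theorem norm_chebCoeff_le_of_hasDerivAt {s : Set ℝ} (hs : s.Countable) :
    ∀ (m : ℕ) {F : ℕ → ℝ → ℂ},
      (∀ i < m, ContinuousOn (F i) (Icc (-1 : ℝ) 1)) →
      (∀ i < m, ∀ x ∈ Ioo (-1 : ℝ) 1 \ s, HasDerivAt (F i) (F (i + 1) x) x) →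
      (∀ i ≤ m, IntervalIntegrable (fun θ : ℝ => F i (Real.cos θ)) volume 0 π) →
      ∀ {j : ℕ}, m ≤ j →
        ‖chebCoeff (F 0) j‖ ≤
          (2 / π * ∫ θ in (0 : ℝ)..π, ‖F m (Real.cos θ)‖) / (j.descFactorial m : ℝ)
  | 0, F, _, _, hint, j, _ => by
    rw [Nat.descFactorial_zero, Nat.cast_one, div_one]
    exact norm_chebCoeff_le (hint 0 le_rfl) j
  | m + 1, F, hcont, hder, hint, j, hj => by
    have hπ : (0 : ℝ) ≤ π := Real.pi_pos.le
    -- one integration by parts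
    have hstep := chebCoeff_eq_of_hasDerivAt hs (hcont 0 (by omega)) (hder 0 (by omega))
      (hint 1 (by omega)) (m := j) (by omega)
    -- the induction hypothesis for the shifted chain `F 1, F 2, …`
    have ih := fun {j : ℕ} (hj : m ≤ j) =>
      norm_chebCoeff_le_of_hasDerivAt hs m (F := fun i => F (i + 1))
        (fun i hi => hcont (i + 1) (by omega)) (fun i hi => hder (i + 1) (by omega))
        (fun i hi => hint (i + 1) (by omega)) hj
    set W : ℝ := 2 / π * ∫ θ in (0 : ℝ)..π, ‖F (m + 1) (Real.cos θ)‖ with hW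
    have hW0 : 0 ≤ W := mul_nonneg (by positivity)
      (intervalIntegral.integral_nonneg hπ fun θ _ => norm_nonneg _)
    have h1 : ‖chebCoeff (F 1) (j - 1)‖ ≤ W / ((j - 1).descFactorial m : ℝ) := ih (by omega)
    have h2 : ‖chebCoeff (F 1) (j + 1)‖ ≤ W / ((j + 1).descFactorial m : ℝ) := ih (by omega)
    -- `(j+1) (j) ⋯ ≥ (j-1) (j-2) ⋯`
    have hpos : (0 : ℝ) < ((j - 1).descFactorial m : ℝ) := by
      exact_mod_cast Nat.descFactorial_pos.mpr (by omega)
    have hmono : ((j - 1).descFactorial m : ℝ) ≤ ((j + 1).descFactorial m : ℝ) := by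
      exact_mod_cast Nat.descFactorial_le m (show j - 1 ≤ j + 1 by omega)
    have h2' : ‖chebCoeff (F 1) (j + 1)‖ ≤ W / ((j - 1).descFactorial m : ℝ) :=
      h2.trans (div_le_div_of_nonneg_left hW0 hpos hmono)
    have hprod : (j.descFactorial (m + 1) : ℝ) = j * ((j - 1).descFactorial m : ℝ) := by
      obtain ⟨i, rfl⟩ : ∃ i, j = i + 1 := ⟨j - 1, by omega⟩
      rw [Nat.succ_descFactorial_succ]
      push_cast
      simp
    have hj0 : (0 : ℝ) < j := by exact_mod_cast (show 0 < j by omega)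
    have hn : ‖(2 * j : ℂ)‖ = 2 * j := by
      rw [show (2 * j : ℂ) = ((2 * j : ℝ) : ℂ) by push_cast; rfl, Complex.norm_real,
        Real.norm_of_nonneg (by positivity)]
    simp only [zero_add] at hstep
    rw [hstep, norm_div, hprod, hn, div_le_div_iff₀ (by positivity) (by positivity)]
    calc ‖chebCoeff (F 1) (j - 1) - chebCoeff (F 1) (j + 1)‖ * (j * ((j - 1).descFactorial m : ℝ))
        ≤ (W / ((j - 1).descFactorial m : ℝ) + W / ((j - 1).descFactorial m : ℝ)) *
            (j * ((j - 1).descFactorial m : ℝ)) :=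
          mul_le_mul_of_nonneg_right ((norm_sub_le _ _).trans (add_le_add h1 h2'))
            (by positivity)
      _ = W * (2 * j) := by
          field_simp
          ring

/-! ### The tail sum `Σ_{j ≥ M} 1/(j (j-1) ⋯ (j-k))` -/

/-- `k / (j (j-1) ⋯ (j-k)) = 1/((j-1) ⋯ (j-k)) - 1/(j ⋯ (j-k+1))` (`j ≥ k + 1`). [folklore] -/
private theorem div_descFactorial_succ_eq_sub {k j : ℕ} (hj : k + 1 ≤ j) :
    (k : ℝ) / (j.descFactorial (k + 1) : ℝ) =
      1 / ((j - 1).descFactorial k : ℝ) - 1 / (j.descFactorial k : ℝ) := by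
  obtain ⟨i, rfl⟩ : ∃ i, j = i + 1 := ⟨j - 1, by omega⟩
  have h1 : ((i + 1).descFactorial (k + 1) : ℝ) = (i + 1 : ℕ) * (i.descFactorial k : ℝ) := by
    rw [Nat.succ_descFactorial_succ]
    push_cast
    ring
  have h2 : ((i + 1).descFactorial (k + 1) : ℝ) = (i + 1 - k : ℕ) * ((i + 1).descFactorial k : ℝ) := by
    rw [Nat.descFactorial_succ]
    push_cast
    ring
  have hp0 : (0 : ℝ) < (i.descFactorial k : ℝ) := by
    exact_mod_cast Nat.descFactorial_pos.mpr (by omega)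
  have hp1 : (0 : ℝ) < ((i + 1).descFactorial k : ℝ) := by
    exact_mod_cast Nat.descFactorial_pos.mpr (by omega)
  have hp2 : (0 : ℝ) < ((i + 1).descFactorial (k + 1) : ℝ) := by
    exact_mod_cast Nat.descFactorial_pos.mpr (by omega)
  have hi1 : (0 : ℝ) < ((i + 1 : ℕ) : ℝ) := by positivity
  have hik : ((i + 1 - k : ℕ) : ℝ) = (i : ℝ) + 1 - k := by
    rw [Nat.cast_sub (by omega)]
    push_cast
    ring
  rw [show i + 1 - 1 = i from rfl]
  rw [show (1 : ℝ) / (i.descFactorial k : ℝ) = ((i + 1 : ℕ) : ℝ) / ((i + 1).descFactorial (k + 1) : ℝ) by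
    rw [h1]; field_simp]
  rw [show (1 : ℝ) / ((i + 1).descFactorial k : ℝ) =
      ((i + 1 - k : ℕ) : ℝ) / ((i + 1).descFactorial (k + 1) : ℝ) by
    rw [h2, hik]
    have : (0 : ℝ) < (i : ℝ) + 1 - k := by
      have : (k : ℝ) ≤ i := by exact_mod_cast (show k ≤ i by omega)
      linarith
    field_simp]
  rw [hik, ← sub_div]
  congr 1
  push_cast
  ring

/-- **Tail of the series `Σ 1/(j (j-1) ⋯ (j-k))`** (the inequality used for Trefethen 2008 (4.10)):
for `k ≥ 1` and `M ≥ k + 1`, `Σ_{j ≥ M} 1/(j (j-1) ⋯ (j-k)) ≤ 1 / (k (M-1) (M-2) ⋯ (M-k))`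
(telescoping; loc. cit. bounds the same tail by `∫_{M-1}^∞ dx/(x-k)^{k+1} = 1/(k (M-1-k)^k)`).
[cite: Trefethen2008, Thm. 4.3 (4.10)] -/
theorem tsum_one_div_descFactorial_le {k M : ℕ} (hk : 1 ≤ k) (hM : k + 1 ≤ M) :
    Summable (fun i : ℕ => 1 / ((M + i).descFactorial (k + 1) : ℝ)) ∧
      ∑' i : ℕ, 1 / ((M + i).descFactorial (k + 1) : ℝ) ≤
        1 / (k * ((M - 1).descFactorial k : ℝ)) := by
  set P : ℕ → ℝ := fun i => 1 / ((M - 1 + i).descFactorial k : ℝ) with hP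
  have hk0 : (0 : ℝ) < k := by exact_mod_cast hk
  have hterm : ∀ i : ℕ, 1 / ((M + i).descFactorial (k + 1) : ℝ) = (P i - P (i + 1)) / k := by
    intro i
    have h := div_descFactorial_succ_eq_sub (k := k) (j := M + i) (by omega)
    simp only [hP]
    rw [show M - 1 + i = M + i - 1 by omega, show M - 1 + (i + 1) = M + i by omega, ← h]
    field_simp
  have hnonneg : ∀ i : ℕ, 0 ≤ 1 / ((M + i).descFactorial (k + 1) : ℝ) := fun i => by positivity
  have hPnn : ∀ i : ℕ, 0 ≤ P i := fun i => by positivity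
  have hpartial : ∀ n : ℕ, ∑ i ∈ Finset.range n, 1 / ((M + i).descFactorial (k + 1) : ℝ) ≤
      1 / (k * ((M - 1).descFactorial k : ℝ)) := by
    intro n
    simp_rw [hterm]
    rw [← Finset.sum_div, Finset.sum_range_sub']
    have hP0 : P 0 = 1 / ((M - 1).descFactorial k : ℝ) := by simp [hP]
    rw [hP0, div_le_iff₀ hk0]
    have : 1 / (k * ((M - 1).descFactorial k : ℝ)) * k = 1 / ((M - 1).descFactorial k : ℝ) := by
      field_simp
    rw [this]
    linarith [hPnn n]
  exact ⟨summable_of_sum_range_le hnonneg hpartial, Real.tsum_le_of_sum_range_le hnonneg hpartial⟩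

/-! ### `∫_{-1}^{1} T_j` -/

/-- `∫_{-1}^{1} T_j(x) dx = ∫_0^π cos(jθ) sin θ dθ` (`x = cos θ`). [folklore] -/
private theorem integral_T_eq_integral_cos_mul_sin (j : ℤ) :
    ∫ x in (-1 : ℝ)..1, (T ℝ j).eval x = ∫ θ in (0 : ℝ)..π, Real.cos (j * θ) * Real.sin θ := by
  have h := intervalIntegral.integral_comp_mul_deriv' (a := (0 : ℝ)) (b := π) (f := Real.cos)
    (f' := fun θ => -Real.sin θ) (g := fun x : ℝ => (T ℝ j).eval x)
    (fun θ _ => Real.hasDerivAt_cos θ) (by fun_prop) (Polynomial.continuous _).continuousOn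
  rw [Real.cos_zero, Real.cos_pi, intervalIntegral.integral_symm (-1 : ℝ) 1] at h
  have h' : ∫ x in (-1 : ℝ)..1, (T ℝ j).eval x =
      -∫ θ in (0 : ℝ)..π, ((fun x : ℝ => (T ℝ j).eval x) ∘ Real.cos) θ * -Real.sin θ := by
    rw [h, neg_neg]
  rw [h', ← intervalIntegral.integral_neg]
  refine intervalIntegral.integral_congr fun θ _ => ?_
  simp only [Function.comp_apply, T_real_cos]
  ring

/-- `|∫_{-1}^{1} T_j| ≤ 2 / (j² - 1)` for `j ≥ 2` (indeed `∫ T_j = 2/(1-j²)` for even `j`, `0` for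
odd `j`; Trefethen 2008, proof of Thm. 5.1, (5.2)–(5.3)). [cite: Trefethen2008, Thm. 4.5 (4.13)] -/
theorem abs_integral_T_le {j : ℕ} (hj : 2 ≤ j) :
    |∫ x in (-1 : ℝ)..1, (T ℝ j).eval x| ≤ 2 / ((j : ℝ) ^ 2 - 1) := by
  have hj1 : (1 : ℝ) < j := by exact_mod_cast hj
  have hjm : (0 : ℝ) < (j : ℝ) - 1 := by linarith
  have hjp : (0 : ℝ) < (j : ℝ) + 1 := by linarith
  -- antiderivative of `cos(jθ) sin θ = (sin((j+1)θ) - sin((j-1)θ))/2`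
  set G : ℝ → ℝ := fun θ => Real.cos ((j - 1) * θ) / (2 * (j - 1)) -
    Real.cos ((j + 1) * θ) / (2 * (j + 1)) with hG
  have hGd : ∀ θ : ℝ, HasDerivAt G (Real.cos (j * θ) * Real.sin θ) θ := by
    intro θ
    have h1 : HasDerivAt (fun θ : ℝ => Real.cos ((j - 1) * θ))
        (-Real.sin ((j - 1) * θ) * ((j - 1) * 1)) θ :=
      ((hasDerivAt_id' θ).const_mul ((j : ℝ) - 1)).cos
    have h2 : HasDerivAt (fun θ : ℝ => Real.cos ((j + 1) * θ))
        (-Real.sin ((j + 1) * θ) * ((j + 1) * 1)) θ :=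
      ((hasDerivAt_id' θ).const_mul ((j : ℝ) + 1)).cos
    have h := (h1.div_const (2 * ((j : ℝ) - 1))).sub (h2.div_const (2 * ((j : ℝ) + 1)))
    refine h.congr_deriv ?_
    rw [show ((j : ℝ) - 1) * θ = j * θ - θ by ring, show ((j : ℝ) + 1) * θ = j * θ + θ by ring,
      Real.sin_sub, Real.sin_add]
    field_simp
    ring
  have hint : ∫ θ in (0 : ℝ)..π, Real.cos (j * θ) * Real.sin θ = G π - G 0 :=
    intervalIntegral.integral_eq_sub_of_hasDerivAt (fun θ _ => hGd θ)
      (by apply Continuous.intervalIntegrable; fun_prop)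
  have hT := integral_T_eq_integral_cos_mul_sin (j : ℤ)
  push_cast at hT
  rw [hT, hint]
  -- `cos((j+1)π) = cos((j-1)π)`, so `G π - G 0 = -(1 - cos((j-1)π)) / ((j-1)(j+1))`
  have hc : Real.cos (((j : ℝ) + 1) * π) = Real.cos (((j : ℝ) - 1) * π) := by
    rw [show ((j : ℝ) + 1) * π = ((j : ℝ) - 1) * π + 2 * π by ring, Real.cos_add_two_pi]
  have hval : G π - G 0 = -(1 - Real.cos (((j : ℝ) - 1) * π)) / (((j : ℝ) - 1) * ((j : ℝ) + 1)) := by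
    simp only [hG, mul_zero, Real.cos_zero, hc]
    field_simp
    ring
  rw [hval, abs_div, abs_neg, abs_of_pos (mul_pos hjm hjp),
    show (j : ℝ) ^ 2 - 1 = ((j : ℝ) - 1) * ((j : ℝ) + 1) by ring]
  refine div_le_div_of_nonneg_right ?_ (mul_pos hjm hjp).le
  rw [abs_le]
  constructor <;> linarith [Real.neg_one_le_cos (((j : ℝ) - 1) * π),
    Real.cos_le_one (((j : ℝ) - 1) * π)]

end Literature.Analysis.Quadrature
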